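import Literature.MathematicalPhysics.QuantumFieldTheory.BalabanImbrieJaffe1984to88.BIJ88Restr592Proof
import Literature.MathematicalPhysics.QuantumFieldTheory.BalabanImbrieJaffe1984to88.BIJ88ChargePowerLogScale

/-!
# `BalabanImbrieJaffe1984to88.BIJ88Passage593Regime` — T. Bałaban, J. Imbrie, A. Jaffe, *Effective action and cluster
properties of the abelian Higgs model*, Commun. Math. Phys. **114** (1988) 257–315 [BalabanImbrieJaffe1988]:
pp. 296–297 [PDF 40–41], inside the proof of **(5.9.3)**, verbatim *"Thus in going from the old |D_{ū_k}ψ| to the new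
|D_{ū_{k+1}}ψ| we make errors of the order of ce_kp(e_k)³λ_k^{−1/4}, (L^kε)^d < λ or ce_kp(e_k)³(λ^{−1/2}(L^kε)^{(d−2)/2} + (L^kε)^{−1}),
(L^kε)^d ≧ λ. In both cases this is bounded by e^β(L^kε/ε₀)^{1/4−α} — see the discussion below of the bounds on interaction
terms. The desired bound follows."* — the sentence **«In both cases this is bounded by e^β(L^kε/ε₀)^{1/4−α}»** PROVED as an
explicit-threshold statement in the printed parametrization ((2.2) `e_k = (L^kε)^{(4−d)/2}e`, `λ_k = (L^kε)^{4−d}λ`, (2.33)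
`p(e_k) = |log e_k⁻¹|^p`, d = 2, 3, the stopping rule of p. 273 `L^kε < ε₀ = min{1,(8λ/e²)^{1/2}}e^β ≤ e^β`, fixed `λ, p > 0`,
*"α, β small and positive"* (p. 298) as `0 < α ≤ ¼`, `0 ≤ β < 1`, and the standing *"e ≪ 1"* as an explicit `e ≤ e₀(c, λ, p, α, β, d)`),
and the closing **«The desired bound follows»** KNITTED with p02 g6's `BIJ88Restr592Proof.passage593_order` (the printed
error structure of the passage ū_k → ū_{k+1}) into r16's leaf `BIJ88Sect5StatementsPart2.Ineq593` for `D_{ū_{k+1}}ψ` (kind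
«hence-step» for row **C2.Eq5.9.3**; theorems only).

statement-level skeleton of published theorems with citation tags; proofs where landed; nothing here is a claim about the Yang–Mills mass gap

PDF held: `paper:balaban1988-cmp114-bij-abelian-higgs-effective-action` (journal page = PDF page + 256); pp. 296–297 [PDF 40–41]
read this session from the text layer (`p0040.txt` l.29–35, `p0041.txt` l.1–3), with (2.2) p. 260, (2.33) p. 263, (4.1) p. 273,
p. 276 (*"O(e^{β−α}(L^kε/ε₀)^{1/4−α}), with α > 0, small, α < β"*) and p. 298 (*"bounded by e^β(L^kε/ε₀)^{1/4−α}, with α, β small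
and positive"*).

CITATION HEADER (lean-in-tree rule).  Part of the lit-balaban TYPED SKELETON (HOME `run/shared/lean/pub/lit-balaban/`), Phase 2,
seat p02 gen 7 (unit `lit-balaban-p02`); row **C2.Eq5.9.3** of `HOME/lit-balaban-r16/ROWS-C2-part2.md` (fold owner r16, referee
ref-5).  State of the row before this file: the printed FIRST STEP (`D_{ū_k}ψ` from (5.2.2)) proved by p36 g3
(`BIJ88Ineq593Proof.ineq593_first`); the passage `ū_k → ū_{k+1}` proved as STRUCTURE + printed ORDERS by p02 g6
(`BIJ88Restr592Proof.passage593_small/_large/_order`, under the gauge-defect datum `|ū_{k+1}(b) − ū_k(b)| ≤ c₁e_kp(e_k)²`, prose in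
print); the sentences «In both cases this is bounded by e^β(L^kε/ε₀)^{1/4−α}» and «The desired bound follows» untyped.
WHAT IS PROVED HERE (0 `sorry`, standard axioms, no definitions, no named facts; kernels in `BIJ88ChargePowerLogScale`):
* §1 **`passage593_bound_small`** — for d ≤ 3 there is `e₀ > 0` depending only on `c, λ, p, α, β, d` with
  `c·e_k·p(e_k)³·λ_k^{−1/4} ≤ e^β(L^kε/ε₀)^{1/4−α}` for all `0 < e ≤ e₀`, ALL `0 < L^kε ≤ 1` and all `0 < ε₀ ≤ e^β` (so in particular in
  the printed regime `(L^kε)^d < λ`);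
* §2 **`passage593_bound_large`** — for d = 2, 3, same dependence: `c·e_k·p(e_k)³·(λ^{−1/2}(L^kε)^{(d−2)/2} + (L^kε)^{−1}) ≤ e^β(L^kε/ε₀)^{1/4−α}`
  for all `0 < e ≤ e₀`, `0 < L^kε ≤ 1` with `λ ≤ (L^kε)^d`, `0 < ε₀ ≤ e^β`;
* §3 **`ineq593_of_passage`** (abstract closing step), **`ineq593_next`** (on the S3 carrier: (5.9.2) `Restr592` + defect datum + first
  step `Ineq593 … (D_{ū_k}ψ) c′ p(e_k)` ⇒ `Ineq593 … (D_{ū_{k+1}}ψ) (c′+1) p(e_k)` for `e ≤ e₀(c, c₁, λ, p, α, β, d)`, `0 < L^kε ≤ ε₀ ≤ e^β`),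
  **`ineq593_next_printed`** (the same in r18's vocabulary `eK`/`lamK`/`pLog`/`eps0`/`Continues`).
READINGS (declared): `e^β` with e = the CHARGE (as `BIJ88Sect4Statements.eps0`; GAPS G-C2-p36-04); every constant uniform in `k`;
the paper's pointer *"see the discussion below of the bounds on interaction terms"* (p. 298) is not otherwise used — the comparison is
proved directly.  NOT here: the size `c₁e_kp(e_k)²` of the gauge defect (prose in print; hypothesis), the first step (hypothesis,
supplied in the model by p36's `ineq593_first`), the insertion of `χ_{k+1,Λ₀^{(k)′}}` (`BIJ88Restr592Proof.chiNext_eq_one`); no Summits import.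
-/

namespace Literature.MathematicalPhysics.QuantumFieldTheory.BalabanImbrieJaffe1984to88.BIJ88Passage593Regime

open Literature.MathematicalPhysics.QuantumFieldTheory.Balaban1983to89
open BIJ88Sect2Statements (pLog)
open BIJ88Sect3Statements BIJ88Sect5StatementsPart2 BIJ88Sect5StatementsPart4 BIJ88Restr592Proof BIJ88ChargePowerLogScale

/-! ## §1 «In both cases this is bounded by e^β(L^kε/ε₀)^{1/4−α}» — the case (L^kε)^d < λ -/

section Small

/-- **p. 296–297, first case** [PDF 40–41]: *"we make errors of the order of ce_kp(e_k)³λ_k^{−1/4}, (L^kε)^d < λ … In both cases this is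
bounded by e^β(L^kε/ε₀)^{1/4−α}"* — PROVED, uniformly in the scale: for d ≤ 3, `c ≥ 0`, `λ, p > 0`, `0 < α ≤ ¼`, `0 ≤ β < 1` there is
`e₀ > 0` depending on `c, λ, p, α, β, d` ONLY such that for every bare charge `0 < e ≤ e₀`, every scale `0 < s = L^kε ≤ 1` and every
stopping scale `0 < ε₀ ≤ e^β` (the printed `ε₀ = min{1,(8λ/e²)^{1/2}}e^β`, `eps0_le_rpow`),
`c·e_k·p(e_k)³·λ_k^{−1/4} ≤ e^β(s/ε₀)^{1/4−α}` with `e_k = s^{(4−d)/2}e`, `λ_k = s^{4−d}λ` (2.2), `p(e_k) = |log e_k⁻¹|^p` (2.33).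
Mechanism (*"e ≪ 1"*, p. 273): the left side equals `e^{β(3/4+α)}s^{1/4−α} · [cλ^{−1/4}·e^{1−β(3/4+α)}·s^{(3−d)/4+α}·(log e_k⁻¹)^{3p}]`, the
bracket is `≤ ½` for small `e` uniformly in `s ∈ (0,1]` (`logmix_bound`), and `e^{β(3/4+α)}s^{1/4−α} ≤ e^β(s/ε₀)^{1/4−α}` (`vertex_lower`).
[cite: BalabanImbrieJaffe1988, (5.9.3) p.297] -/
theorem passage593_bound_small {d : ℕ} (hd : d ≤ 3) {c lam p α β : ℝ} (hc : 0 ≤ c) (hlam : 0 < lam) (hp : 0 < p)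
    (hα : 0 < α) (hα4 : α ≤ 1 / 4) (hβ0 : 0 ≤ β) (hβ : β < 1) :
    ∃ e₀ > 0, ∀ e s ε₀ : ℝ, 0 < e → e ≤ e₀ → 0 < s → s ≤ 1 → 0 < ε₀ → ε₀ ≤ e ^ β →
      c * (s ^ ((4 - (d : ℝ)) / 2) * e) * pLog p (s ^ ((4 - (d : ℝ)) / 2) * e) ^ 3 *
          (s ^ (4 - (d : ℝ)) * lam) ^ (-(1 / 4 : ℝ))
        ≤ e ^ β * (s / ε₀) ^ (1 / 4 - α) := by
  -- the exponents and constants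
  set m : ℝ := (4 - (d : ℝ)) / 2 with hm_def
  have hd3 : (d : ℝ) ≤ 3 := by exact_mod_cast hd
  have hm0 : 0 ≤ m := by rw [hm_def]; linarith
  set γ : ℝ := m / 2 - 1 / 4 + α with hγ_def
  have hγ : 0 < γ := by rw [hγ_def, hm_def]; linarith
  set q : ℝ := 3 * p with hq_def
  have hq : 0 < q := by rw [hq_def]; linarith
  set θ : ℝ := 1 - β * (3 / 4 + α) with hθ_def
  have hθ : 0 < θ := by
    have : β * (3 / 4 + α) ≤ β := by nlinarith
    rw [hθ_def]; linarith
  set K : ℝ := c * lam ^ (-(1 / 4 : ℝ)) with hK_def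
  have hK : 0 ≤ K := mul_nonneg hc (Real.rpow_nonneg hlam.le _)
  set C : ℝ := K * 2 ^ q * (m ^ q * (q / γ) ^ q + (2 * q / θ) ^ q) with hC_def
  have hC : 0 ≤ C := by
    rw [hC_def]
    refine mul_nonneg (mul_nonneg hK (Real.rpow_nonneg (by norm_num) _)) (add_nonneg ?_ ?_)
    · exact mul_nonneg (Real.rpow_nonneg hm0 _) (Real.rpow_nonneg (div_pos hq hγ).le _)
    · exact Real.rpow_nonneg (by positivity) _
  refine ⟨min 1 ((2 * C + 1) ^ (-(2 / θ))), lt_min one_pos (Real.rpow_pos_of_pos (by linarith) _), ?_⟩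
  intro e s ε₀ he hele hs hs1 hε₀ hε₀e
  have he1 : e ≤ 1 := hele.trans (min_le_left _ _)
  have heth : e ≤ (2 * C + 1) ^ (-(2 / θ)) := hele.trans (min_le_right _ _)
  -- the bracket Z ≤ 1/2
  set L : ℝ := m * Real.log s⁻¹ + Real.log e⁻¹ with hL_def
  have hZ : K * e ^ θ * s ^ γ * L ^ q ≤ 1 / 2 :=
    (logmix_bound hK hγ hq hm0 hθ hs hs1 he he1).trans (small_of_le_threshold hC hθ he heth)
  -- both sides through the normal form `c·e·λ^{−1/4}·s^{m/2}·L^q`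
  have h4d : (4 - (d : ℝ)) = 2 * m := by rw [hm_def]; ring
  have hP : pLog p (s ^ m * e) ^ 3 = L ^ q := by rw [hL_def, hq_def]; exact pLog_pow_three hs hs1 he he1 hm0
  have hlamk : (s ^ (4 - (d : ℝ)) * lam) ^ (-(1 / 4 : ℝ)) = lam ^ (-(1 / 4 : ℝ)) * s ^ (-(m / 2)) := by
    rw [h4d]; exact lamk_rpow_neg_quarter_eq hs hlam.le
  have hD : s ^ m * s ^ (-(m / 2)) = s ^ (m / 2) := by rw [← Real.rpow_add hs]; congr 1; ring
  have hAB : e ^ (β * (3 / 4 + α)) * e ^ θ = e := by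
    have : β * (3 / 4 + α) + θ = 1 := by rw [hθ_def]; ring
    rw [← Real.rpow_add he, this, Real.rpow_one]
  have hCC : s ^ (1 / 4 - α) * s ^ γ = s ^ (m / 2) := by rw [← Real.rpow_add hs]; congr 1; rw [hγ_def]; ring
  have hLHS : c * (s ^ m * e) * pLog p (s ^ m * e) ^ 3 * (s ^ (4 - (d : ℝ)) * lam) ^ (-(1 / 4 : ℝ))
      = c * e * lam ^ (-(1 / 4 : ℝ)) * s ^ (m / 2) * L ^ q := by
    rw [hP, hlamk]
    calc c * (s ^ m * e) * L ^ q * (lam ^ (-(1 / 4 : ℝ)) * s ^ (-(m / 2)))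
        = c * e * lam ^ (-(1 / 4 : ℝ)) * (s ^ m * s ^ (-(m / 2))) * L ^ q := by ring
      _ = c * e * lam ^ (-(1 / 4 : ℝ)) * s ^ (m / 2) * L ^ q := by rw [hD]
  have hKEY : e ^ (β * (3 / 4 + α)) * s ^ (1 / 4 - α) * (K * e ^ θ * s ^ γ * L ^ q)
      = c * e * lam ^ (-(1 / 4 : ℝ)) * s ^ (m / 2) * L ^ q := by
    rw [hK_def]
    calc e ^ (β * (3 / 4 + α)) * s ^ (1 / 4 - α) * (c * lam ^ (-(1 / 4 : ℝ)) * e ^ θ * s ^ γ * L ^ q)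
        = c * lam ^ (-(1 / 4 : ℝ)) * (e ^ (β * (3 / 4 + α)) * e ^ θ) * (s ^ (1 / 4 - α) * s ^ γ) * L ^ q := by ring
      _ = c * e * lam ^ (-(1 / 4 : ℝ)) * s ^ (m / 2) * L ^ q := by rw [hAB, hCC]; ring
  have hR0 : 0 ≤ e ^ (β * (3 / 4 + α)) * s ^ (1 / 4 - α) := mul_nonneg (Real.rpow_nonneg he.le _) (Real.rpow_nonneg hs.le _)
  rw [hLHS, ← hKEY]
  calc e ^ (β * (3 / 4 + α)) * s ^ (1 / 4 - α) * (K * e ^ θ * s ^ γ * L ^ q)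
      ≤ e ^ (β * (3 / 4 + α)) * s ^ (1 / 4 - α) * 1 := mul_le_mul_of_nonneg_left (hZ.trans (by norm_num)) hR0
    _ ≤ e ^ β * (s / ε₀) ^ (1 / 4 - α) := by rw [mul_one]; exact vertex_lower he hs hε₀ hε₀e hα4

end Small

/-! ## §2 «In both cases this is bounded by e^β(L^kε/ε₀)^{1/4−α}» — the case (L^kε)^d ≧ λ (d = 2, 3) -/

section Large

/-- **p. 296–297, second case** [PDF 40–41]: *"… or ce_kp(e_k)³(λ^{−1/2}(L^kε)^{(d−2)/2} + (L^kε)^{−1}), (L^kε)^d ≧ λ. In both cases this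
is bounded by e^β(L^kε/ε₀)^{1/4−α}"* — PROVED: for d = 2, 3, `c ≥ 0`, `λ, p > 0`, `0 < α ≤ ¼`, `0 ≤ β < 1` there is `e₀ > 0` depending
on `c, λ, p, α, β, d` ONLY such that for every `0 < e ≤ e₀`, every scale `0 < s = L^kε ≤ 1` WITH `λ ≤ s^d` and every `0 < ε₀ ≤ e^β`,
`c·e_k·p(e_k)³·(λ^{−1/2}s^{(d−2)/2} + s^{−1}) ≤ e^β(s/ε₀)^{1/4−α}`.  Mechanism: with `e_k = s^{(4−d)/2}e` the first term is
`cλ^{−1/2}·e·s·p(e_k)³ = e^{β(3/4+α)}s^{1/4−α}·[cλ^{−1/2}e^{1−β(3/4+α)}s^{3/4+α}p(e_k)³]` (`logmix_bound`); the second is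
`c·e·s^{(2−d)/2}p(e_k)³ = e^{β(3/4+α)}s^{1/4−α}·[c·e^{1−β(3/4+α)}s^{(3−2d)/4+α}p(e_k)³]` where, IN THIS REGIME, `s ≥ λ^{1/d}` bounds the
non-positive power of `s` and `log s⁻¹ ≤ (1/d)|log λ|` (`logconst_bound`); each bracket `≤ ½` for small `e`. [cite: BalabanImbrieJaffe1988, (5.9.3) p.297] -/
theorem passage593_bound_large {d : ℕ} (hd2 : 2 ≤ d) (hd : d ≤ 3) {c lam p α β : ℝ} (hc : 0 ≤ c) (hlam : 0 < lam)
    (hp : 0 < p) (hα : 0 < α) (hα4 : α ≤ 1 / 4) (hβ0 : 0 ≤ β) (hβ : β < 1) :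
    ∃ e₀ > 0, ∀ e s ε₀ : ℝ, 0 < e → e ≤ e₀ → 0 < s → s ≤ 1 → 0 < ε₀ → ε₀ ≤ e ^ β → lam ≤ s ^ d →
      c * (s ^ ((4 - (d : ℝ)) / 2) * e) * pLog p (s ^ ((4 - (d : ℝ)) / 2) * e) ^ 3 *
          (lam ^ (-(1 / 2 : ℝ)) * s ^ (((d : ℝ) - 2) / 2) + s⁻¹)
        ≤ e ^ β * (s / ε₀) ^ (1 / 4 - α) := by
  -- the exponents and constants
  set m : ℝ := (4 - (d : ℝ)) / 2 with hm_def
  have hd2' : (2 : ℝ) ≤ d := by exact_mod_cast hd2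
  have hd3 : (d : ℝ) ≤ 3 := by exact_mod_cast hd
  have hm0 : 0 ≤ m := by rw [hm_def]; linarith
  have hm1 : m ≤ 1 := by rw [hm_def]; linarith
  set q : ℝ := 3 * p with hq_def
  have hq : 0 < q := by rw [hq_def]; linarith
  set θ : ℝ := 1 - β * (3 / 4 + α) with hθ_def
  have hθ : 0 < θ := by
    have : β * (3 / 4 + α) ≤ β := by nlinarith
    rw [hθ_def]; linarith
  have hd0 : d ≠ 0 := by omega
  have hdpos : (0 : ℝ) < d := by exact_mod_cast (show 0 < d by omega)
  -- first term
  set γ₁ : ℝ := 3 / 4 + α with hγ₁_def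
  have hγ₁ : 0 < γ₁ := by rw [hγ₁_def]; linarith
  set K₁ : ℝ := c * lam ^ (-(1 / 2 : ℝ)) with hK₁_def
  have hK₁ : 0 ≤ K₁ := mul_nonneg hc (Real.rpow_nonneg hlam.le _)
  set C₁ : ℝ := K₁ * 2 ^ q * (m ^ q * (q / γ₁) ^ q + (2 * q / θ) ^ q) with hC₁_def
  have hC₁ : 0 ≤ C₁ := by
    rw [hC₁_def]
    refine mul_nonneg (mul_nonneg hK₁ (Real.rpow_nonneg (by norm_num) _)) (add_nonneg ?_ ?_)
    · exact mul_nonneg (Real.rpow_nonneg hm0 _) (Real.rpow_nonneg (div_pos hq hγ₁).le _)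
    · exact Real.rpow_nonneg (by positivity) _
  -- second term
  set τ : ℝ := m - 5 / 4 + α with hτ_def
  have hτ : τ ≤ 0 := by rw [hτ_def]; linarith
  set Λτ : ℝ := (lam ^ ((d : ℝ)⁻¹)) ^ τ with hΛτ_def
  have hlamd : 0 < lam ^ ((d : ℝ)⁻¹) := Real.rpow_pos_of_pos hlam _
  have hΛτ : 0 < Λτ := Real.rpow_pos_of_pos hlamd _
  set ℓ : ℝ := |Real.log lam| / d with hℓ_def
  have hℓ : 0 ≤ ℓ := div_nonneg (abs_nonneg _) hdpos.le
  set M₀ : ℝ := m * ℓ with hM₀_def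
  have hM₀ : 0 ≤ M₀ := mul_nonneg hm0 hℓ
  set K₂ : ℝ := c * Λτ with hK₂_def
  have hK₂ : 0 ≤ K₂ := mul_nonneg hc hΛτ.le
  set C₂ : ℝ := K₂ * 2 ^ q * (M₀ ^ q + (2 * q / θ) ^ q) with hC₂_def
  have hC₂ : 0 ≤ C₂ := by
    rw [hC₂_def]
    exact mul_nonneg (mul_nonneg hK₂ (Real.rpow_nonneg (by norm_num) _))
      (add_nonneg (Real.rpow_nonneg hM₀ _) (Real.rpow_nonneg (by positivity) _))
  refine ⟨min 1 (min ((2 * C₁ + 1) ^ (-(2 / θ))) ((2 * C₂ + 1) ^ (-(2 / θ)))),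
    lt_min one_pos (lt_min (Real.rpow_pos_of_pos (by linarith) _) (Real.rpow_pos_of_pos (by linarith) _)), ?_⟩
  intro e s ε₀ he hele hs hs1 hε₀ hε₀e hreg
  have he1 : e ≤ 1 := hele.trans (min_le_left _ _)
  have heth1 : e ≤ (2 * C₁ + 1) ^ (-(2 / θ)) := (hele.trans (min_le_right _ _)).trans (min_le_left _ _)
  have heth2 : e ≤ (2 * C₂ + 1) ^ (-(2 / θ)) := (hele.trans (min_le_right _ _)).trans (min_le_right _ _)
  set L : ℝ := m * Real.log s⁻¹ + Real.log e⁻¹ with hL_def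
  have hls0 : 0 ≤ Real.log s⁻¹ := Real.log_nonneg ((one_le_inv₀ hs).mpr hs1)
  have hle0 : 0 ≤ Real.log e⁻¹ := Real.log_nonneg ((one_le_inv₀ he).mpr he1)
  have hL0 : 0 ≤ L := add_nonneg (mul_nonneg hm0 hls0) hle0
  -- bracket 1 ≤ 1/2
  have hZ1 : K₁ * e ^ θ * s ^ γ₁ * L ^ q ≤ 1 / 2 :=
    (logmix_bound hK₁ hγ₁ hq hm0 hθ hs hs1 he he1).trans (small_of_le_threshold hC₁ hθ he heth1)
  -- the regime: s ≥ λ^{1/d}, hence s^τ ≤ Λτ and log s⁻¹ ≤ ℓ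
  have hsl : lam ^ ((d : ℝ)⁻¹) ≤ s := by
    have h := Real.rpow_le_rpow hlam.le hreg (inv_nonneg.2 hdpos.le)
    rwa [Real.pow_rpow_inv_natCast hs.le hd0] at h
  have hsτ : s ^ τ ≤ Λτ := Real.rpow_le_rpow_of_nonpos hlamd hsl hτ
  have hls : Real.log s⁻¹ ≤ ℓ := by
    have h1 : Real.log (lam ^ ((d : ℝ)⁻¹)) ≤ Real.log s := Real.log_le_log hlamd hsl
    rw [Real.log_rpow hlam] at h1
    have h3 : (d : ℝ)⁻¹ * (-Real.log lam) ≤ (d : ℝ)⁻¹ * |Real.log lam| :=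
      mul_le_mul_of_nonneg_left (neg_le_abs _) (inv_nonneg.2 hdpos.le)
    rw [Real.log_inv, hℓ_def, div_eq_inv_mul]
    linarith
  have hLle : L ≤ M₀ + Real.log e⁻¹ := by
    rw [hL_def, hM₀_def]
    exact add_le_add (mul_le_mul_of_nonneg_left hls hm0) le_rfl
  have hLq : L ^ q ≤ (M₀ + Real.log e⁻¹) ^ q := Real.rpow_le_rpow hL0 hLle hq.le
  -- bracket 2 ≤ 1/2
  have hZ2 : c * e ^ θ * s ^ τ * L ^ q ≤ 1 / 2 := by
    have step : c * e ^ θ * s ^ τ * L ^ q ≤ K₂ * e ^ θ * (M₀ + Real.log e⁻¹) ^ q := by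
      rw [hK₂_def]
      calc c * e ^ θ * s ^ τ * L ^ q = c * e ^ θ * (s ^ τ * L ^ q) := by ring
        _ ≤ c * e ^ θ * (Λτ * (M₀ + Real.log e⁻¹) ^ q) :=
            mul_le_mul_of_nonneg_left (mul_le_mul hsτ hLq (Real.rpow_nonneg hL0 _) hΛτ.le)
              (mul_nonneg hc (Real.rpow_nonneg he.le _))
        _ = c * Λτ * e ^ θ * (M₀ + Real.log e⁻¹) ^ q := by ring
    exact step.trans ((logconst_bound hK₂ hq hM₀ hθ he he1).trans (small_of_le_threshold hC₂ hθ he heth2))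
  -- normal forms of the two printed terms
  have hP : pLog p (s ^ m * e) ^ 3 = L ^ q := by rw [hL_def, hq_def]; exact pLog_pow_three hs hs1 he he1 hm0
  have hT1 : c * (s ^ m * e) * L ^ q * (lam ^ (-(1 / 2 : ℝ)) * s ^ (((d : ℝ) - 2) / 2))
      = c * lam ^ (-(1 / 2 : ℝ)) * e * s * L ^ q := by
    have h1 : s ^ m * s ^ (((d : ℝ) - 2) / 2) = s := by
      have : m + ((d : ℝ) - 2) / 2 = 1 := by rw [hm_def]; ring
      rw [← Real.rpow_add hs, this, Real.rpow_one]
    calc c * (s ^ m * e) * L ^ q * (lam ^ (-(1 / 2 : ℝ)) * s ^ (((d : ℝ) - 2) / 2))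
        = c * lam ^ (-(1 / 2 : ℝ)) * e * (s ^ m * s ^ (((d : ℝ) - 2) / 2)) * L ^ q := by ring
      _ = c * lam ^ (-(1 / 2 : ℝ)) * e * s * L ^ q := by rw [h1]
  have hT2 : c * (s ^ m * e) * L ^ q * s⁻¹ = c * e * s ^ (m - 1) * L ^ q := by
    have h1 : s ^ m * s⁻¹ = s ^ (m - 1) := by rw [Real.rpow_sub_one hs.ne', div_eq_mul_inv]
    calc c * (s ^ m * e) * L ^ q * s⁻¹ = c * e * (s ^ m * s⁻¹) * L ^ q := by ring
      _ = c * e * s ^ (m - 1) * L ^ q := by rw [h1]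
  -- the identities `term = e^{β(3/4+α)}s^{1/4−α} · bracket`
  have hAB : e ^ (β * (3 / 4 + α)) * e ^ θ = e := by
    have : β * (3 / 4 + α) + θ = 1 := by rw [hθ_def]; ring
    rw [← Real.rpow_add he, this, Real.rpow_one]
  have hS1 : s ^ (1 / 4 - α) * s ^ γ₁ = s := by
    have : 1 / 4 - α + γ₁ = 1 := by rw [hγ₁_def]; ring
    rw [← Real.rpow_add hs, this, Real.rpow_one]
  have hS2 : s ^ (1 / 4 - α) * s ^ τ = s ^ (m - 1) := by rw [← Real.rpow_add hs]; congr 1; rw [hτ_def]; ring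
  have hKEY1 : e ^ (β * (3 / 4 + α)) * s ^ (1 / 4 - α) * (K₁ * e ^ θ * s ^ γ₁ * L ^ q)
      = c * lam ^ (-(1 / 2 : ℝ)) * e * s * L ^ q := by
    rw [hK₁_def]
    calc e ^ (β * (3 / 4 + α)) * s ^ (1 / 4 - α) * (c * lam ^ (-(1 / 2 : ℝ)) * e ^ θ * s ^ γ₁ * L ^ q)
        = c * lam ^ (-(1 / 2 : ℝ)) * (e ^ (β * (3 / 4 + α)) * e ^ θ) * (s ^ (1 / 4 - α) * s ^ γ₁) * L ^ q := by ring
      _ = c * lam ^ (-(1 / 2 : ℝ)) * e * s * L ^ q := by rw [hAB, hS1]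
  have hKEY2 : e ^ (β * (3 / 4 + α)) * s ^ (1 / 4 - α) * (c * e ^ θ * s ^ τ * L ^ q)
      = c * e * s ^ (m - 1) * L ^ q := by
    calc e ^ (β * (3 / 4 + α)) * s ^ (1 / 4 - α) * (c * e ^ θ * s ^ τ * L ^ q)
        = c * (e ^ (β * (3 / 4 + α)) * e ^ θ) * (s ^ (1 / 4 - α) * s ^ τ) * L ^ q := by ring
      _ = c * e * s ^ (m - 1) * L ^ q := by rw [hAB, hS2]
  have hR0 : 0 ≤ e ^ (β * (3 / 4 + α)) * s ^ (1 / 4 - α) := mul_nonneg (Real.rpow_nonneg he.le _) (Real.rpow_nonneg hs.le _)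
  -- assemble
  rw [hP, mul_add, hT1, hT2, ← hKEY1, ← hKEY2]
  calc e ^ (β * (3 / 4 + α)) * s ^ (1 / 4 - α) * (K₁ * e ^ θ * s ^ γ₁ * L ^ q)
        + e ^ (β * (3 / 4 + α)) * s ^ (1 / 4 - α) * (c * e ^ θ * s ^ τ * L ^ q)
      ≤ e ^ (β * (3 / 4 + α)) * s ^ (1 / 4 - α) * (1 / 2) + e ^ (β * (3 / 4 + α)) * s ^ (1 / 4 - α) * (1 / 2) :=
        add_le_add (mul_le_mul_of_nonneg_left hZ1 hR0) (mul_le_mul_of_nonneg_left hZ2 hR0)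
    _ = e ^ (β * (3 / 4 + α)) * s ^ (1 / 4 - α) := by ring
    _ ≤ e ^ β * (s / ε₀) ^ (1 / 4 - α) := vertex_lower he hs hε₀ hε₀e hα4

end Large

/-! ## §3 «The desired bound follows» — (5.9.3) for `D_{ū_{k+1}}ψ` from the first step, the passage and the regime bound -/

section Knit

/-- the closing step in abstract form: a first-step bound `|D_old ψ(b)| ≤ c′p(e_k)` on the region (p. 296 *"We prove the bound first for
D_{ū_k}ψ"*), a passage `|D_new ψ(b)| ≤ |D_old ψ(b)| + E` (p. 296 *"in going from the old |D_{ū_k}ψ| to the new |D_{ū_{k+1}}ψ| we make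
errors"*) and `E ≤ p(e_k)` give r16's leaf `Ineq593` for `D_new ψ` with constant `c′ + 1` — *"The desired bound follows."*
[cite: BalabanImbrieJaffe1988, (5.9.3) p.297] -/
theorem ineq593_of_passage {Bond : Type} (inRegion : Bond → Prop) (Dold Dnew : Bond → ℂ) {c' pek E : ℝ}
    (hfirst : Ineq593 Bond inRegion Dold c' pek) (hpass : ∀ b, inRegion b → ‖Dnew b‖ ≤ ‖Dold b‖ + E) (hE : E ≤ pek) :
    Ineq593 Bond inRegion Dnew (c' + 1) pek := by
  intro b hb
  have h1 := hfirst b hb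
  have h2 := hpass b hb
  linarith

variable {P : Params} {j : ℕ}

/-- **(5.9.3) for `D_{ū_{k+1}}ψ`, pp. 296–297** [PDF 40–41] — «The desired bound follows», KNITTED on the S3 carrier: for d = 2, 3,
`c, c₁ ≥ 0`, `λ, p > 0`, `0 < α ≤ ¼`, `0 ≤ β < 1` there is `e₀ > 0` (depending on `c, c₁, λ, p, α, β, d` only) such that for every bare
charge `0 < e ≤ e₀`, scale `0 < s = L^kε ≤ ε₀ ≤ e^β` (p. 273), with `e_k = s^{(4−d)/2}e`, `λ_k = s^{4−d}λ` (2.2), `p(e_k)` (2.33): IF ψ obeys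
the restrictions (5.9.2) on Λ₀^{(k)′} (r16's `Restr592 c p(e_k) λ_k λ s d Λ₀′ ψ`), the gauge defect of the passage is
`|ū_{k+1}(b) − ū_k(b)| ≤ c₁e_kp(e_k)²` on bonds into Λ₀′ (prose in print; the datum of p02 g6's `passage593_order`), and the FIRST STEP
holds, `|D_{ū_k}ψ(b)| ≤ c′p(e_k)` (p36's `BIJ88Ineq593Proof.ineq593_first` shape), THEN `|D_{ū_{k+1}}ψ(b)| ≤ (c′+1)p(e_k)` on bonds into
Λ₀′, i.e. `Ineq593 … (D_{ū_{k+1}}ψ) (c′+1) p(e_k)`: the passage errors (`passage593_order`, both regimes `s^d < λ` / `λ ≤ s^d`) are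
`≤ e^β(s/ε₀)^{1/4−α}` (`passage593_bound_small`/`_large`) `≤ 1 ≤ p(e_k)` (`vertex_le_one`, `one_le_pLog`). [cite: BalabanImbrieJaffe1988, (5.9.3) p.297] -/
theorem ineq593_next {d : ℕ} (hd2 : 2 ≤ d) (hd : d ≤ 3) {c c₁ lam p α β : ℝ} (hc : 0 ≤ c) (hc₁ : 0 ≤ c₁) (hlam : 0 < lam)
    (hp : 0 < p) (hα : 0 < α) (hα4 : α ≤ 1 / 4) (hβ0 : 0 ≤ β) (hβ : β < 1) :
    ∃ e₀ > 0, ∀ e s ε₀ : ℝ, 0 < e → e ≤ e₀ → 0 < s → s ≤ ε₀ → ε₀ ≤ e ^ β →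
      ∀ {ek lamk pek : ℝ}, ek = s ^ ((4 - (d : ℝ)) / 2) * e → lamk = s ^ (4 - (d : ℝ)) * lam → pek = pLog p ek →
      ∀ {Λ0' : Finset (Balaban1983to89.Site P j)} {ψ : Balaban1983to89.Site P j → ℂ} (ubar ubar' : PBond P j → ℂ) {c' : ℝ},
        Restr592 c pek lamk lam s d Λ0' ψ →
        (∀ b : PBond P j, b.tgt ∈ Λ0' → ‖ubar' b - ubar b‖ ≤ c₁ * ek * pek ^ 2) →
        Ineq593 (PBond P j) (fun b => b.tgt ∈ Λ0') (covD 1 ubar ψ) c' pek →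
        Ineq593 (PBond P j) (fun b => b.tgt ∈ Λ0') (covD 1 ubar' ψ) (c' + 1) pek := by
  obtain ⟨eA, heA, hA⟩ := passage593_bound_small hd (c := c₁ * c) (mul_nonneg hc₁ hc) hlam hp hα hα4 hβ0 hβ
  obtain ⟨eB, heB, hB⟩ := passage593_bound_large hd2 hd (c := c₁ * (1 + c)) (mul_nonneg hc₁ (by linarith)) hlam hp hα hα4 hβ0 hβ
  refine ⟨min (Real.exp (-1)) (min eA eB), lt_min (Real.exp_pos _) (lt_min heA heB), ?_⟩
  intro e s ε₀ he hele hs hsε₀ hε₀e ek lamk pek hek hlamk hpek Λ0' ψ ubar ubar' c' h592 hδ hfirst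
  have hd3 : (d : ℝ) ≤ 3 := by exact_mod_cast hd
  have hm0 : 0 ≤ (4 - (d : ℝ)) / 2 := by linarith
  have heexp : e ≤ Real.exp (-1) := hele.trans (min_le_left _ _)
  have he1 : e ≤ 1 := heexp.trans (by
    have := Real.exp_le_one_iff.2 (show (-1 : ℝ) ≤ 0 by norm_num)
    exact this)
  have heA' : e ≤ eA := (hele.trans (min_le_right _ _)).trans (min_le_left _ _)
  have heB' : e ≤ eB := (hele.trans (min_le_right _ _)).trans (min_le_right _ _)
  have hε₀ : 0 < ε₀ := hs.trans_le hsε₀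
  have hs1 : s ≤ 1 := hsε₀.trans (hε₀e.trans (Real.rpow_le_one he.le he1 hβ0))
  -- e_k ≤ e ≤ 1/e, so p(e_k) ≥ 1
  have hek0 : 0 < ek := by rw [hek]; exact mul_pos (Real.rpow_pos_of_pos hs _) he
  have hek1 : ek ≤ Real.exp (-1) := by
    rw [hek]
    calc s ^ ((4 - (d : ℝ)) / 2) * e ≤ 1 * e :=
        mul_le_mul_of_nonneg_right (Real.rpow_le_one hs.le hs1 hm0) he.le
      _ = e := one_mul _
      _ ≤ Real.exp (-1) := heexp
  have hp1 : 1 ≤ pek := by rw [hpek]; exact one_le_pLog hp.le hek0 hek1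
  -- the vertex factor is ≤ 1 ≤ p(e_k)
  have hV : e ^ β * (s / ε₀) ^ (1 / 4 - α) ≤ pek := (vertex_le_one he he1 hβ0 hs hsε₀ hα4).trans hp1
  refine ineq593_of_passage (fun b : PBond P j => b.tgt ∈ Λ0') (covD 1 ubar ψ) (covD 1 ubar' ψ) hfirst ?_ hV
  intro b hb
  have hord := passage593_order h592 hc hc₁ hek0.le hp1 hlam hs ubar ubar' hb (hδ b hb)
  by_cases hreg : lam ≤ s ^ d
  · have h := hord.2 hreg
    have hEB := hB e s ε₀ he heB' hs hs1 hε₀ hε₀e hreg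
    rw [← hek, ← hpek] at hEB
    linarith
  · have h := hord.1 (lt_of_not_ge hreg)
    have hEA := hA e s ε₀ he heA' hs hs1 hε₀ hε₀e
    rw [← hek, ← hlamk, ← hpek] at hEA
    linarith

/-- **(5.9.3) for `D_{ū_{k+1}}ψ` IN THE PRINTED VOCABULARY** — r18's (2.2) `eK L ε e d k`, `lamK L ε λ d k`, (2.33) `pLog`, and the
p. 273 stopping rule `Continues L ε ε₀ k` (`L^kε < ε₀`) with the printed `ε₀ = eps0 λ e β = min{1,(8λ/e²)^{1/2}}e^β`: for d = 2, 3 and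
small bare charge `e ≤ e₀(c, c₁, λ, p, α, β, d)`, at every step k of the induction the restrictions (5.9.2), the gauge defect
`≤ c₁e_kp(e_k)²` and the first step `|D_{ū_k}ψ| ≤ c′p(e_k)` give `|D_{ū_{k+1}}ψ(b)| ≤ (c′+1)p(e_k)` on bonds into Λ₀^{(k)′}.
[cite: BalabanImbrieJaffe1988, (5.9.3) p.297] -/
theorem ineq593_next_printed {d : ℕ} (hd2 : 2 ≤ d) (hd : d ≤ 3) {c c₁ lam p α β : ℝ} (hc : 0 ≤ c) (hc₁ : 0 ≤ c₁)
    (hlam : 0 < lam) (hp : 0 < p) (hα : 0 < α) (hα4 : α ≤ 1 / 4) (hβ0 : 0 ≤ β) (hβ : β < 1) :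
    ∃ e₀ > 0, ∀ {L ε e : ℝ} {k : ℕ}, 0 < L → 0 < ε → 0 < e → e ≤ e₀ →
      BIJ88Sect4Statements.Continues L ε (BIJ88Sect4Statements.eps0 lam e β) k →
      ∀ {Λ0' : Finset (Balaban1983to89.Site P j)} {ψ : Balaban1983to89.Site P j → ℂ} (ubar ubar' : PBond P j → ℂ) {c' : ℝ},
        Restr592 c (pLog p (BIJ88Sect2Statements.eK L ε e d k)) (BIJ88Sect2Statements.lamK L ε lam d k) lam (L ^ k * ε) d Λ0' ψ →
        (∀ b : PBond P j, b.tgt ∈ Λ0' →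
          ‖ubar' b - ubar b‖ ≤ c₁ * BIJ88Sect2Statements.eK L ε e d k * pLog p (BIJ88Sect2Statements.eK L ε e d k) ^ 2) →
        Ineq593 (PBond P j) (fun b => b.tgt ∈ Λ0') (covD 1 ubar ψ) c' (pLog p (BIJ88Sect2Statements.eK L ε e d k)) →
        Ineq593 (PBond P j) (fun b => b.tgt ∈ Λ0') (covD 1 ubar' ψ) (c' + 1) (pLog p (BIJ88Sect2Statements.eK L ε e d k)) := by
  obtain ⟨e₀, he₀, h⟩ := ineq593_next (P := P) (j := j) hd2 hd hc hc₁ hlam hp hα hα4 hβ0 hβ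
  refine ⟨e₀, he₀, ?_⟩
  intro L ε e k hL hε he hele hcont Λ0' ψ ubar ubar' c' h592 hδ hfirst
  have hs : 0 < L ^ k * ε := mul_pos (pow_pos hL k) hε
  have hsε₀ : L ^ k * ε ≤ BIJ88Sect4Statements.eps0 lam e β := le_of_lt hcont
  exact h e (L ^ k * ε) (BIJ88Sect4Statements.eps0 lam e β) he hele hs hsε₀ (eps0_le_rpow he β) rfl rfl rfl
    ubar ubar' h592 hδ hfirst

end Knit

end Literature.MathematicalPhysics.QuantumFieldTheory.BalabanImbrieJaffe1984to88.BIJ88Passage593Regime
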